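/-
Copyright (c) 2026 the pub-hodgecm-mathlib formalisation cell (harness21).  Prover seat hodgecm-mathlib-K2E4-p14 (g5), Track B ∕ K2-LIT, h413 =
`stmt-HodgeConjecture-24833`, line `K2_E1_TraceFormulaBeta`, campaign «EIS-RANK-ONE» rung R6f(ii); DEAL «EIS-R6f-ii» `K2E1MaassSelbergU` of the dealer K2E1-plan (g3)
2026-09-04T05:13:55Z («N = 3 first then `_two`»): the `U(J₂)` twin of ★ `K2E1MaassSelbergU.maassSelberg_inner_truncation_three` — 5Res on the same rails as 12R3.
-/
import Summits.HodgeConjecture.HodgeConjecture.Theorems.K2E1MaassSelbergU   -- ★ (this seat): §0∕§1 algebra (every `N`), the `‖x‖⁻¹`-weight idele evaluations, the `U(J₃)` relation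
import HarnessLib

/-!
# K2·E1 — `K2E1MaassSelbergUTwo`: THE RANK-ONE MAASS–SELBERG RELATION FOR `U(J₂)`, HYPOTHESIS-FIRST
# (campaign «EIS-RANK-ONE», rung R6f(ii) at `N = 2`: `⟨Λ^T E f, Λ^T E f′⟩_X = c_μ·K·((T^{s₁}∕s₁)[Ψ₁] + (T^{s₂}∕s₂)[Ψ₂] − (T^{−s₂}∕s₂)[Ψ₃] − (T^{−s₁}∕s₁)[Ψ₄])`)

Track B ∕ K2-LIT, crux h413 = `stmt-HodgeConjecture-24833`, route of record `HCCMUnconditional`; cell `hodgecm-mathlib`, squad K2, ENGINE E1.  Prover seat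
`hodgecm-mathlib-K2E4-p14` (g5); DEAL «EIS-R6f-ii» of the dealer K2E1-plan (g3) 2026-09-04T05:13:55Z.  THEOREMS ONLY (no `def`, no `instance`, no notation, no named-fact
hypothesis, no `sorry`); lane `--supports stmt-HodgeConjecture-24833 --as helper` (count-neutral).  Closes no socket.

WHAT.  The `U(J₂)` instance of the hypothesis-first Maass–Selberg assembly: ★ `K2E1MaassSelbergFourBrackets` §0 at `N = 2` (`hSiegel` = ★ `siegel_two`) and §1 (any measure space),
and the `‖x‖⁻¹`-weight idele-class evaluations ★ `K2E1MaassSelbergU.integrableOn_and_setIntegral_norm_inv_smul_indicator_le ∕ _lt` (at `N = 2` the modulus is `δ_B = H`, so the (δ)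
weight of K2E4-p11's ★ p857556 is `‖x‖⁻¹` and the flat-section densities carry `‖x‖^{s+1}`).  Exponents for flat sections `f = φ H^z`, `f′ = φ′ H^{z′}`: `s₁ = z + conj z′ − 1`,
`s₂ = z − conj z′`; sub-tube `0 < Re s₁`, `0 < Re s₂`.  Same binder list as the `U(J₃)` theorem with `3 ↦ 2`, `(‖x‖·‖x‖)⁻¹ ↦ ‖x‖⁻¹`, `+2 ↦ +1`. [MoeglinWaldspurger1995, IV.2.1–IV.2.3;
Arthur1980TraceFormulaII, §4; Garrett2018, §11.3]
HONEST LABEL: HC_CM is proved only modulo the 7 printed citations (2 remaining named inputs: hLiu418 = `stmt-HodgeConjecture-24832`, h413 = `stmt-HodgeConjecture-24833`) until rung 0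
closes; this file asserts no named fact and closes no socket.
-/

set_option autoImplicit false
-- the mandated namespace repeats the single-problem summit's segment (`HodgeConjecture.HodgeConjecture`)
set_option linter.dupNamespace false

noncomputable section

open MeasureTheory Measure NumberField IsDedekindDomain Set MulAction
open scoped ENNReal NNReal ComplexConjugate
open Literature.MeasureTheory.Group Literature.NumberTheory
open Literature.NumberTheory.Automorphic Literature.NumberTheory.Automorphic.UnitaryGroup
open Summit.HodgeConjecture.HodgeConjecture.Cruxes.H413.K2E1BorelEisensteinU
open Summit.HodgeConjecture.HodgeConjecture.Cruxes.H413.K2E1IdeleClassMellinWeighted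
open Summit.HodgeConjecture.HodgeConjecture.Cruxes.H413.K2E1TorusHeightMellin
open Summit.HodgeConjecture.HodgeConjecture.Cruxes.H413.K2E1MaassSelbergFourBrackets
open Summit.HodgeConjecture.HodgeConjecture.Cruxes.H413.K2E1MaassSelbergU

namespace Summit.HodgeConjecture.HodgeConjecture.Cruxes.H413.K2E1MaassSelbergUTwo

open AdelicGroupData
open Summit.HodgeConjecture.HodgeConjecture.Cruxes.H413.K2E1TruncatedEisensteinExplicit (siegel_two)

variable {F E : Type} [Field F] [NumberField F] [Field E] [NumberField E] [Algebra F E] {c : E ≃ₐ[F] E}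
variable [MeasurableSpace (quasiSplit F E c 2).Adelic] [BorelSpace (quasiSplit F E c 2).Adelic]
variable [MeasurableSpace (adelicUnipotent F E c 2)]
variable [MeasurableSpace (AdeleRing (𝓞 E) E)ˣ] [BorelSpace (AdeleRing (𝓞 E) E)ˣ]

/-- **THE RANK-ONE MAASS–SELBERG RELATION FOR `U(J₂)`, HYPOTHESIS-FIRST, ON THE SUB-TUBE `0 < Re s₁`, `0 < Re s₂`** (`s₁ = z + conj z′ − 1`, `s₂ = z − conj z′` for flat sections of
exponents `z, z′` — `δ_B = H` at `N = 2`, so the weight is `‖x‖⁻¹` and the densities carry `+1`; road «B» steps (1)–(7) assembled BY NAME, `hSiegel` = ★ `siegel_two`).  `μ` automorphic on `X`, `ν_G` inversion-invariant Haar, `ν_I` left-invariant on `𝕀_E` with idele class domain `𝓕_I`: there is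
ONE `c_μ > 0` (Weil, ★ §0) such that for every covering weight `β` of `B(F)♯`, `T ≥ 1`, Borel left-`B(F)`-invariant `f, Mf, f′, Mf′` with `E(f)_B = f + Mf` on `{H > T}` and `E(f)`
convergent, bounded Borel `G(F)`-invariant `Λ′` (= `Λ^T E f′`, ★ R6e) with `∫⁻ β‖ψ‖ₑ < ∞`, the averaging∕constant-term∕adjoint∕R6a inputs of ★ §1 (`hAVG`, `hCT′`, `hadj`, `hM′ψ`,
`hi₁…₅`), and the four weight-level-to-idele-class evaluations `hδ₁…₄` ((δ) of K2E4-p11 composed with the flat-section densities; one constant `Kδ`) with bounded measurable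
`E^×·M`-invariant idele weights `Ψ₁…Ψ₄`:
**`∫_X quotFun (Λ^T E f) · conj (quotFun Λ′) dμ = c_μ · Kδ · ( (T^{s₁}∕s₁)·[Ψ₁] + (T^{s₂}∕s₂)·[Ψ₂] − (T^{−s₂}∕s₂)·[Ψ₃] − (T^{−s₁}∕s₁)·[Ψ₄] )`**, `[Ψ] = ∫_{𝓕_I ∩ {‖x‖≤1}} ‖x‖·Ψ dν_I`.
[cite: MoeglinWaldspurger1995, IV.2.1–IV.2.3] [cite: Arthur1980TraceFormulaII, §4] [cite: Garrett2018, §11.3] -/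
theorem maassSelberg_inner_truncation_two
    (μ : Measure (quasiSplit F E c 2).automorphicQuotient) [(quasiSplit F E c 2).IsAutomorphicMeasure μ]
    (νG : Measure (quasiSplit F E c 2).Adelic) [νG.IsHaarMeasure] [νG.IsInvInvariant]
    (νI : Measure (AdeleRing (𝓞 E) E)ˣ) [νI.IsMulLeftInvariant] [IsFiniteMeasureOnCompacts νI] [νI.IsOpenPosMeasure]
    {𝓕I : Set (AdeleRing (𝓞 E) E)ˣ} (h𝓕I : IsIdeleClassDomain E 𝓕I) :
    ∃ cμ : ℝ, 0 < cμ ∧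
      ∀ {β : (quasiSplit F E c 2).Adelic → ℝ≥0∞}, IsCoveringWeight ((arithmeticBorel F E c 2).map (quasiSplit F E c 2).arithmeticSubgroup.subtype) β →
      ∀ {ν : Measure (adelicUnipotent F E c 2)} {𝓕 : Set (adelicUnipotent F E c 2)} {T : ℝ≥0}, 1 ≤ T →
      ∀ {f Mf f' Mf' Λ' CT' : (quasiSplit F E c 2).Adelic → ℂ} {M M' : ((quasiSplit F E c 2).Adelic → ℂ) → ((quasiSplit F E c 2).Adelic → ℂ)},
      -- ★ §0 inputs (X → weight level)
      Measurable f → Measurable Mf →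
        (∀ b ∈ arithmeticBorel F E c 2, ∀ x : (quasiSplit F E c 2).Adelic, f ((b : (quasiSplit F E c 2).Adelic) * x) = f x) →
        (∀ b ∈ arithmeticBorel F E c 2, ∀ x : (quasiSplit F E c 2).Adelic, Mf ((b : (quasiSplit F E c 2).Adelic) * x) = Mf x) →
        (∀ x : (quasiSplit F E c 2).Adelic, T < borelHeight x → borelConstantTerm ν 𝓕 (eisensteinSeriesU f) x = f x + Mf x) →
        (∀ g : (quasiSplit F E c 2).Adelic,
          Summable fun q : Quotient (orbitRel ↥(borelU (c : E →+* E) ((StdForm.antidiagonal 2).over E)) ↥(unitaryGroupOfForm (c : E →+* E) ((StdForm.antidiagonal 2).over E))) =>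
            f ((quasiSplit F E c 2).toAdelic (q.out : ↥(unitaryGroupOfForm (c : E →+* E) ((StdForm.antidiagonal 2).over E))) * g)) →
        Measurable Λ' → (∀ (γ : (quasiSplit F E c 2).arithmeticSubgroup) (x : (quasiSplit F E c 2).Adelic), Λ' ((γ : (quasiSplit F E c 2).Adelic) * x) = Λ' x) →
        ∀ {M₁ : ℝ}, (∀ g, ‖Λ' g‖ ≤ M₁) →
        ∫⁻ g, β g * ‖{y : (quasiSplit F E c 2).Adelic | borelHeight y ≤ T}.indicator f g - {y : (quasiSplit F E c 2).Adelic | T < borelHeight y}.indicator Mf g‖ₑ ∂νG < ∞ →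
      -- ★ §1 inputs (averaging, two-piece constant term, adjoint, R6a, integrability)
        ∫ g, (β g).toReal • (({y : (quasiSplit F E c 2).Adelic | borelHeight y ≤ T}.indicator f g - {y : (quasiSplit F E c 2).Adelic | T < borelHeight y}.indicator Mf g) * conj (Λ' g)) ∂νG =
          ∫ g, (β g).toReal • (({y : (quasiSplit F E c 2).Adelic | borelHeight y ≤ T}.indicator f g - {y : (quasiSplit F E c 2).Adelic | T < borelHeight y}.indicator Mf g) * conj (CT' g)) ∂νG →
        (∀ g, CT' g = {y : (quasiSplit F E c 2).Adelic | borelHeight y ≤ T}.indicator (f' + Mf') g - M ({y : (quasiSplit F E c 2).Adelic | T < borelHeight y}.indicator (f' + Mf')) g) →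
        ∫ g, (β g).toReal • (({y : (quasiSplit F E c 2).Adelic | borelHeight y ≤ T}.indicator f g - {y : (quasiSplit F E c 2).Adelic | T < borelHeight y}.indicator Mf g) * conj (M ({y : (quasiSplit F E c 2).Adelic | T < borelHeight y}.indicator (f' + Mf')) g)) ∂νG =
          ∫ g, (β g).toReal • (M' (fun x => {y : (quasiSplit F E c 2).Adelic | borelHeight y ≤ T}.indicator f x - {y : (quasiSplit F E c 2).Adelic | T < borelHeight y}.indicator Mf x) g * conj ({y : (quasiSplit F E c 2).Adelic | T < borelHeight y}.indicator (f' + Mf') g)) ∂νG →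
        (∀ g, T < borelHeight g → M' (fun x => {y : (quasiSplit F E c 2).Adelic | borelHeight y ≤ T}.indicator f x - {y : (quasiSplit F E c 2).Adelic | T < borelHeight y}.indicator Mf x) g = Mf g) →
        Integrable (fun g => (β g).toReal • ({y : (quasiSplit F E c 2).Adelic | borelHeight y ≤ T}.indicator f g * conj (f' g))) νG →
        Integrable (fun g => (β g).toReal • ({y : (quasiSplit F E c 2).Adelic | borelHeight y ≤ T}.indicator f g * conj (Mf' g))) νG →
        Integrable (fun g => (β g).toReal • ({y : (quasiSplit F E c 2).Adelic | T < borelHeight y}.indicator Mf g * conj (f' g))) νG →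
        Integrable (fun g => (β g).toReal • ({y : (quasiSplit F E c 2).Adelic | T < borelHeight y}.indicator Mf g * conj (Mf' g))) νG →
        Integrable (fun g => (β g).toReal • (({y : (quasiSplit F E c 2).Adelic | borelHeight y ≤ T}.indicator f g - {y : (quasiSplit F E c 2).Adelic | T < borelHeight y}.indicator Mf g) * conj (M ({y : (quasiSplit F E c 2).Adelic | T < borelHeight y}.indicator (f' + Mf')) g))) νG →
      -- (δ) composed with the flat-section densities: weight level → idele class, one constant `Kδ`, exponents `s₁, s₂`, weights `Ψ₁…Ψ₄`
      ∀ {Kδ : ℝ} {s₁ s₂ : ℂ}, 0 < s₁.re → 0 < s₂.re → ∀ {Ψ₁ Ψ₂ Ψ₃ Ψ₄ : (AdeleRing (𝓞 E) E)ˣ → ℂ},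
      Measurable Ψ₁ → ∀ {C₁ : ℝ}, (∀ x, ‖Ψ₁ x‖ ≤ C₁) → (∀ k ∈ GaloisRepresentations.principalIdeles E, ∀ x, Ψ₁ (k * x) = Ψ₁ x) →
        (∀ (r : ℝ≥0ˣ) (x : (AdeleRing (𝓞 E) E)ˣ), Ψ₁ (posRealIdele E r * x) = Ψ₁ x) →
      Measurable Ψ₂ → ∀ {C₂ : ℝ}, (∀ x, ‖Ψ₂ x‖ ≤ C₂) → (∀ k ∈ GaloisRepresentations.principalIdeles E, ∀ x, Ψ₂ (k * x) = Ψ₂ x) →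
        (∀ (r : ℝ≥0ˣ) (x : (AdeleRing (𝓞 E) E)ˣ), Ψ₂ (posRealIdele E r * x) = Ψ₂ x) →
      Measurable Ψ₃ → ∀ {C₃ : ℝ}, (∀ x, ‖Ψ₃ x‖ ≤ C₃) → (∀ k ∈ GaloisRepresentations.principalIdeles E, ∀ x, Ψ₃ (k * x) = Ψ₃ x) →
        (∀ (r : ℝ≥0ˣ) (x : (AdeleRing (𝓞 E) E)ˣ), Ψ₃ (posRealIdele E r * x) = Ψ₃ x) →
      Measurable Ψ₄ → ∀ {C₄ : ℝ}, (∀ x, ‖Ψ₄ x‖ ≤ C₄) → (∀ k ∈ GaloisRepresentations.principalIdeles E, ∀ x, Ψ₄ (k * x) = Ψ₄ x) →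
        (∀ (r : ℝ≥0ˣ) (x : (AdeleRing (𝓞 E) E)ˣ), Ψ₄ (posRealIdele E r * x) = Ψ₄ x) →
        ∫ g, (β g).toReal • ({y : (quasiSplit F E c 2).Adelic | borelHeight y ≤ T}.indicator f g * conj (f' g)) ∂νG =
          (Kδ : ℂ) * ∫ x in 𝓕I, ((IdeleClassGroup.ideleNorm E x : ℝ))⁻¹ • {x : (AdeleRing (𝓞 E) E)ˣ | (IdeleClassGroup.ideleNorm E x : ℝ) ≤ (T : ℝ)}.indicator (fun x => ((IdeleClassGroup.ideleNorm E x : ℝ) : ℂ) ^ (s₁ + 1) * Ψ₁ x) x ∂νI →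
        ∫ g, (β g).toReal • ({y : (quasiSplit F E c 2).Adelic | borelHeight y ≤ T}.indicator f g * conj (Mf' g)) ∂νG =
          (Kδ : ℂ) * ∫ x in 𝓕I, ((IdeleClassGroup.ideleNorm E x : ℝ))⁻¹ • {x : (AdeleRing (𝓞 E) E)ˣ | (IdeleClassGroup.ideleNorm E x : ℝ) ≤ (T : ℝ)}.indicator (fun x => ((IdeleClassGroup.ideleNorm E x : ℝ) : ℂ) ^ (s₂ + 1) * Ψ₂ x) x ∂νI →
        ∫ g, (β g).toReal • ({y : (quasiSplit F E c 2).Adelic | T < borelHeight y}.indicator Mf g * conj (f' g)) ∂νG =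
          (Kδ : ℂ) * ∫ x in 𝓕I, ((IdeleClassGroup.ideleNorm E x : ℝ))⁻¹ • {x : (AdeleRing (𝓞 E) E)ˣ | (T : ℝ) < (IdeleClassGroup.ideleNorm E x : ℝ)}.indicator (fun x => ((IdeleClassGroup.ideleNorm E x : ℝ) : ℂ) ^ (-s₂ + 1) * Ψ₃ x) x ∂νI →
        ∫ g, (β g).toReal • ({y : (quasiSplit F E c 2).Adelic | T < borelHeight y}.indicator Mf g * conj (Mf' g)) ∂νG =
          (Kδ : ℂ) * ∫ x in 𝓕I, ((IdeleClassGroup.ideleNorm E x : ℝ))⁻¹ • {x : (AdeleRing (𝓞 E) E)ˣ | (T : ℝ) < (IdeleClassGroup.ideleNorm E x : ℝ)}.indicator (fun x => ((IdeleClassGroup.ideleNorm E x : ℝ) : ℂ) ^ (-s₁ + 1) * Ψ₄ x) x ∂νI →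
      -- THE RELATION
        ∫ x, (quasiSplit F E c 2).quotFun (truncation ν 𝓕 T (eisensteinSeriesU f)) x * conj ((quasiSplit F E c 2).quotFun Λ' x) ∂μ =
          (cμ : ℂ) * ((Kδ : ℂ) *
            ((((T : ℝ) : ℂ) ^ s₁ / s₁) * (∫ x in {x : (AdeleRing (𝓞 E) E)ˣ | (IdeleClassGroup.ideleNorm E x : ℝ) ≤ 1} ∩ 𝓕I, ((IdeleClassGroup.ideleNorm E x : ℝ) : ℂ) * Ψ₁ x ∂νI)
              + (((T : ℝ) : ℂ) ^ s₂ / s₂) * (∫ x in {x : (AdeleRing (𝓞 E) E)ˣ | (IdeleClassGroup.ideleNorm E x : ℝ) ≤ 1} ∩ 𝓕I, ((IdeleClassGroup.ideleNorm E x : ℝ) : ℂ) * Ψ₂ x ∂νI)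
              - (((T : ℝ) : ℂ) ^ (-s₂) / s₂) * (∫ x in {x : (AdeleRing (𝓞 E) E)ˣ | (IdeleClassGroup.ideleNorm E x : ℝ) ≤ 1} ∩ 𝓕I, ((IdeleClassGroup.ideleNorm E x : ℝ) : ℂ) * Ψ₃ x ∂νI)
              - (((T : ℝ) : ℂ) ^ (-s₁) / s₁) * (∫ x in {x : (AdeleRing (𝓞 E) E)ˣ | (IdeleClassGroup.ideleNorm E x : ℝ) ≤ 1} ∩ 𝓕I, ((IdeleClassGroup.ideleNorm E x : ℝ) : ℂ) * Ψ₄ x ∂νI))) := by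
  obtain ⟨cμ, hcμ, h0⟩ := exists_integral_quotFun_truncation_mul_conj_eq_mul_integral_weight (N := 2) siegel_two μ νG
  refine ⟨cμ, hcμ, ?_⟩
  intro β hβ ν 𝓕 T hT f Mf f' Mf' Λ' CT' M M' hfm hMfm hf hMf hCT hsum hΛm hΛG M₁ hΛbdd hψL1 hAVG hCT' hadj hM'ψ hi₁ hi₂ hi₃ hi₄ hi₅
    Kδ s₁ s₂ hs₁ hs₂ Ψ₁ Ψ₂ Ψ₃ Ψ₄ hΨ₁m C₁ hΨ₁C hΨ₁K hΨ₁M hΨ₂m C₂ hΨ₂C hΨ₂K hΨ₂M hΨ₃m C₃ hΨ₃C hΨ₃K hΨ₃M hΨ₄m C₄ hΨ₄C hΨ₄K hΨ₄M hδ₁ hδ₂ hδ₃ hδ₄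
  have hT0 : (0 : ℝ) < (T : ℝ) := lt_of_lt_of_le one_pos (by exact_mod_cast hT)
  rw [(h0 hβ hT hfm hMfm hf hMf hCT hsum hΛm hΛG hΛbdd hψL1).2,
    integral_weight_psi_mul_conj_eq_four_brackets νG β (fun g => borelHeight g) T f Mf f' Mf' Λ' CT' M M' hAVG hCT' hadj hM'ψ hi₁ hi₂ hi₃ hi₄ hi₅,
    hδ₁, hδ₂, hδ₃, hδ₄,
    (integrableOn_and_setIntegral_norm_inv_smul_indicator_le νI h𝓕I hΨ₁m hΨ₁C hΨ₁K hΨ₁M hs₁ hT0).2,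
    (integrableOn_and_setIntegral_norm_inv_smul_indicator_le νI h𝓕I hΨ₂m hΨ₂C hΨ₂K hΨ₂M hs₂ hT0).2,
    (integrableOn_and_setIntegral_norm_inv_smul_indicator_lt νI h𝓕I hΨ₃m hΨ₃C hΨ₃K hΨ₃M hs₂ hT0).2,
    (integrableOn_and_setIntegral_norm_inv_smul_indicator_lt νI h𝓕I hΨ₄m hΨ₄C hΨ₄K hΨ₄M hs₁ hT0).2]
  ring

end Summit.HodgeConjecture.HodgeConjecture.Cruxes.H413.K2E1MaassSelbergUTwo

end
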